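import Mathlib.Analysis.Complex.Schwarz
import Literature.Analysis.Complex.RootsOfUnityComplementUniformization
import Literature.Analysis.Complex.HolomorphicLogarithm
import Literature.Analysis.Complex.RiemannMapping
import HarnessLib

/-!
# The conformal radius of `ℂ ∖ μ_N`: a zero of the universal covering at depth `≍ N⁻²`

`Literature/Analysis/Complex/RootsOfUnityComplementFirstRingZero.lean` — PROOF-ONLY (no definition,
no named fact). Brick B3 of the elementary route to Calegari–Dimitrov–Tang's Theorem 5.1.4 (the
conformal radius of `ℂ ∖ μ_N`, lower-bound form) recorded in
`Summits/…/Cruxes/StarredOptimalManinUnitFiveSeven/Lines/cdt_thm1-radius-elementary-route-g39.md`.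

★ `exists_zero_norm_le_of_isCoveringMap_compl_rootsOfUnity` — every holomorphic covering
`Φ : 𝔻 → {z | zᴺ ≠ 1}` with `Φ(0) = 0` (`N ≥ 1`) has a zero `z₁ ≠ 0` with `‖z₁‖ ≤ 1 − 1/(16 N²)`.
(CDT locate the first ring of zeros of `F_N` at `|z| = cos(π/2N)` from the tessellation of the disc by
`(π/N, 0, 0)`-triangles; here only an explicit upper bound on the depth is proved, by elementary means.)

Proof. Let `F(t) = 16^{1/N}(λ(tᴺ)/16)^{1/N}` (tree: `ModularLambda.exists_root_cuspFunction_modularLambda`),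
so that `F(e^{πiτ/N})ᴺ = λ(τ)`; lift it through the covering, `Φ ∘ ω = F`, `ω(0) = 0`. Let
`h(s) = i/N − 2s` (`0 ≤ s ≤ 1`), `σ(s) = −1/h(s)` (so `σ(0) = iN`, `σ(1) = γ₀(iN)` with
`γ₀ = (1 0; 2 1) ∈ Γ(2)`), `β(s) = e^{πiσ(s)/N}`, `t₀ = β(0) = e^{−π}`, `t₁ = β(1)`,
`|t₁| = e^{−π/(4N²+1)}`. With `ℓ(τ) = log 16 + πiτ + φ(e^{πiτ})` an explicit holomorphic logarithm of
`λ` on `ℍ` (`λ = 16 q u(q)`, `u = e^{φ}` zero-free on the nome disc) and `L` a logarithm of `Φᴺ − 1` on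
the disc, the `S`-law `λ(−1/τ) = 1 − λ(τ)` gives `exp L(ω(β(s))) = exp ℓ(h(s))`, whence
`L(ω t₁) − L(ω t₀) = ℓ(i/N − 2) − ℓ(i/N) = −2πi`. Since `F(t₁)ᴺ = λ(σ(1)) = λ(σ(0)) = F(t₀)ᴺ`,
`F(t₁) = ζ F(t₀)` with `ζᴺ = 1`, and the points `ζ ω(t₀)`, `ω(t₁)` lie in one fibre of `Φ` (rotation
symmetry `Φ(ζz) = ζΦ(z)`); they are DISTINCT because `L(ζ z) = L(z)`. Lifting `Φ ∘ μ`
(`μ` the disc automorphism with `μ(0) = ζ ω(t₀)`) through `Φ` with base point `ω(t₁)` gives a holomorphic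
`T : 𝔻 → 𝔻` with `Φ ∘ T = Φ ∘ μ`, `T(0) = ω(t₁)`; `z₁ := T(μ⁻¹(0))` is a zero of `Φ`, nonzero by
uniqueness of lifts, and the Schwarz–Pick lemma bounds `‖z₁‖ ≤ (|a|+|b|)/(1+|a||b|)` with
`|a| ≤ e^{−π}`, `|b| ≤ e^{−π/(4N²+1)}` (Schwarz for `ω`).

## References
* [CalegariDimitrovTang2025] F. Calegari, V. Dimitrov, Y. Tang, J. Amer. Math. Soc. 38 (2025),
  Theorem 5.1.4 and §5.3 (the zeros of `F_N`).
* [Ahlfors1973] L. V. Ahlfors, *Conformal invariants*, §1-1 (Schwarz–Pick).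
-/

noncomputable section

open Set Metric Filter Real
open scoped Topology ComplexConjugate

namespace Literature.Analysis.Complex

open _root_.Complex Literature.NumberTheory.Automorphic Literature.NumberTheory.Automorphic.ModularLambda
open UpperHalfPlane hiding I

/-! ### §1 Two-point Schwarz–Pick bookkeeping -/

/-- `|φ_{-b}(w)| ≤ (|w| + |b|)/(1 + |w||b|)` for `|b| < 1`, `|w| < 1` (the hyperbolic triangle
inequality through the origin). [cite: Ahlfors1973, §1-1] -/
theorem norm_discMobius_neg_le {b w : ℂ} (hb : ‖b‖ < 1) (hw : ‖w‖ < 1) :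
    ‖discMobius (-b) w‖ ≤ (‖w‖ + ‖b‖) / (1 + ‖w‖ * ‖b‖) := by
  have hb' : ‖-b‖ < 1 := by rwa [norm_neg]
  have hden : 0 < ‖1 - conj (-b) * w‖ := norm_pos_iff.2 (Complex.one_sub_conj_mul_ne_zero hb' hw.le)
  have hpos : 0 < 1 + ‖w‖ * ‖b‖ := by positivity
  rw [discMobius, norm_div, div_le_div_iff₀ hden hpos]
  -- square both sides
  have key := Complex.norm_sq_one_sub_conj_mul_sub (-b) w
  rw [norm_neg] at key
  have h1 : ‖w - -b‖ ≤ ‖w‖ + ‖b‖ := by rw [sub_neg_eq_add]; exact norm_add_le _ _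
  have h2 : ‖1 - conj (-b) * w‖ ≤ 1 + ‖w‖ * ‖b‖ := by
    calc ‖1 - conj (-b) * w‖ ≤ ‖(1 : ℂ)‖ + ‖conj (-b) * w‖ := norm_sub_le _ _
      _ = 1 + ‖w‖ * ‖b‖ := by rw [norm_one, norm_mul, Complex.norm_conj, norm_neg, mul_comm]
  -- `|w+b|² (1+|w||b|)² ≤ (|w|+|b|)² |1 + b̄w|²` from `|1+b̄w|² − |w+b|² = (1−|b|²)(1−|w|²)`
  have hsq : (‖w - -b‖ * (1 + ‖w‖ * ‖b‖)) ^ 2 ≤ ((‖w‖ + ‖b‖) * ‖1 - conj (-b) * w‖) ^ 2 := by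
    have e1 : ‖1 - conj (-b) * w‖ ^ 2 = ‖w - -b‖ ^ 2 + (1 - ‖b‖ ^ 2) * (1 - ‖w‖ ^ 2) := by
      linarith [key]
    rw [mul_pow, mul_pow, e1]
    have hA : ‖w - -b‖ ^ 2 ≤ (‖w‖ + ‖b‖) ^ 2 := pow_le_pow_left₀ (norm_nonneg _) h1 2
    have hP : 0 ≤ (1 - ‖b‖ ^ 2) * (1 - ‖w‖ ^ 2) :=
      mul_nonneg (by nlinarith [norm_nonneg b]) (by nlinarith [norm_nonneg w])
    have hid : (1 + ‖w‖ * ‖b‖) ^ 2 = (‖w‖ + ‖b‖) ^ 2 + (1 - ‖b‖ ^ 2) * (1 - ‖w‖ ^ 2) := by ring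
    rw [hid]
    nlinarith [mul_le_mul_of_nonneg_right hA hP, sq_nonneg (‖w‖ + ‖b‖), sq_nonneg ‖w - -b‖]
  exact le_of_pow_le_pow_left₀ two_ne_zero (by positivity) (by nlinarith [hsq])

/-- **Two-point Schwarz–Pick, radial form.** If `T : 𝔻 → 𝔻` is holomorphic, then for `u ∈ 𝔻`:
`‖T u‖ ≤ (‖u‖ + ‖T 0‖)/(1 + ‖u‖ ‖T 0‖)` (pseudo-hyperbolic distance `δ(Tu, T0) ≤ δ(u, 0) = |u|`).
[cite: Ahlfors1973, §1-1] -/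
theorem norm_le_of_mapsTo_ball_two_point {T : ℂ → ℂ} (hT : DifferentiableOn ℂ T (ball (0 : ℂ) 1))
    (hTm : MapsTo T (ball (0 : ℂ) 1) (ball (0 : ℂ) 1)) {u : ℂ} (hu : ‖u‖ < 1) :
    ‖T u‖ ≤ (‖u‖ + ‖T 0‖) / (1 + ‖u‖ * ‖T 0‖) := by
  have hb0 : (0 : ℂ) ∈ ball (0 : ℂ) 1 := mem_ball_self one_pos
  set b : ℂ := T 0 with hb
  have hb1 : ‖b‖ < 1 := by simpa using hTm hb0
  have hTu : ‖T u‖ < 1 := by simpa using hTm (mem_ball_zero_iff.2 hu)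
  -- `f = φ_b ∘ T` fixes `0`
  set f : ℂ → ℂ := fun z ↦ discMobius b (T z) with hf
  have hfd : DifferentiableOn ℂ f (ball (0 : ℂ) 1) :=
    (Complex.differentiableOn_discMobius hb1).comp hT hTm
  have hfm : MapsTo f (ball (0 : ℂ) 1) (closedBall (0 : ℂ) 1) := fun z hz ↦
    mem_closedBall_zero_iff.2 (Complex.norm_discMobius_lt_one hb1 (by simpa using hTm hz)).le
  have hf0 : f 0 = 0 := by simp [hf, hb]
  have hS : ‖f u‖ ≤ ‖u‖ := Complex.norm_le_norm_of_mapsTo_ball hfd hfm hf0 hu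
  -- invert the Möbius map
  have hinv : T u = discMobius (-b) (f u) := by
    rw [hf]; exact (Complex.discMobius_neg_discMobius hb1 hTu.le).symm
  have hfu1 : ‖f u‖ < 1 := Complex.norm_discMobius_lt_one hb1 hTu
  calc ‖T u‖ = ‖discMobius (-b) (f u)‖ := by rw [hinv]
    _ ≤ (‖f u‖ + ‖b‖) / (1 + ‖f u‖ * ‖b‖) := norm_discMobius_neg_le hb1 hfu1
    _ ≤ (‖u‖ + ‖b‖) / (1 + ‖u‖ * ‖b‖) := by
        -- `x ↦ (x + β)/(1 + xβ)` is monotone for `0 ≤ β < 1`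
        have hβ := norm_nonneg b
        rw [div_le_div_iff₀ (by positivity) (by positivity)]
        nlinarith [mul_nonneg (sub_nonneg.2 hS) (sub_nonneg.2 (sq_nonneg ‖b‖ |>.trans_eq rfl |> fun _ ↦ hb1.le)),
          norm_nonneg (f u), hS, mul_nonneg hβ hβ]

/-! ### §2 An explicit logarithm of `λ` on `ℍ` via the nome -/

/-- **`λ = exp ℓ` with `ℓ(τ) = log 16 + πiτ + φ(e^{πiτ})`**: there is a holomorphic `φ` on the unit
disc with `φ(0) = 0` such that `λ(τ) = exp(log 16 + πiτ + φ(e^{πiτ}))` for `Im τ > 0` (from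
`λ/16 = q · u(q)` with `u` zero-free on the nome disc, `u(0) = 1`). In particular the logarithm
`ℓ` satisfies `ℓ(τ − 2) = ℓ(τ) − 2πi`. [cite: CalegariDimitrovTang2025, §5.3 (λ(q) = 16q − 128q² + …)] -/
theorem exists_log_modularLambda_nome :
    ∃ φ : ℂ → ℂ, DifferentiableOn ℂ φ (ball (0 : ℂ) 1) ∧ φ 0 = 0 ∧
      ∀ τ : ℂ, 0 < τ.im →
        modularLambda τ = Complex.exp ((Real.log 16 : ℝ) + π * Complex.I * τ + φ (Complex.exp (π * Complex.I * τ))) := by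
  set Λ : ℂ → ℂ := cuspFunction 2 (fun τ : ℍ ↦ modularLambda τ / 16) with hΛ
  set u : ℂ → ℂ := dslope Λ 0 with hu
  have hud : DifferentiableOn ℂ u (ball (0 : ℂ) 1) :=
    (Complex.differentiableOn_dslope (ball_mem_nhds (0 : ℂ) one_pos)).mpr
      differentiableOn_cuspFunction_modularLambda
  have hu0 : u 0 = 1 := by rw [hu, dslope_same, deriv_cuspFunction_modularLambda_zero]
  have hune : ∀ q : ℂ, q ≠ 0 → u q = Λ q / q := by
    intro q hq0
    rw [hu, dslope_of_ne _ hq0, slope_def_field, hΛ, cuspFunction_modularLambda_zero, sub_zero, sub_zero]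
  have hu_ne : ∀ q ∈ ball (0 : ℂ) 1, u q ≠ 0 := by
    intro q hq
    rcases eq_or_ne q 0 with rfl | hq0
    · rw [hu0]; exact one_ne_zero
    · rw [hune q hq0]
      exact div_ne_zero (cuspFunction_modularLambda_ne_zero (mem_ball_zero_iff.mp hq) hq0) hq0
  obtain ⟨φ, hφd, hφ0, -, hφ⟩ := exists_log_on_ball hud hu_ne
  refine ⟨φ, hφd, hφ0, fun τ hτ ↦ ?_⟩
  set q : ℂ := Complex.exp (π * Complex.I * τ) with hq
  have hq0 : q ≠ 0 := Complex.exp_ne_zero _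
  have hq1 : ‖q‖ < 1 := by
    rw [hq, Complex.norm_exp]
    have : (π * Complex.I * τ).re = -(π * τ.im) := by
      simp [Complex.mul_re, Complex.mul_im, Complex.I_re, Complex.I_im]
    rw [this, Real.exp_lt_one_iff]
    have := Real.pi_pos
    nlinarith
  have hqball : q ∈ ball (0 : ℂ) 1 := mem_ball_zero_iff.2 hq1
  have hΛq : Λ q = modularLambda τ / 16 := by rw [hΛ, hq]; exact cuspFunction_modularLambda_exp hτ
  have huq : u q = Complex.exp (φ q) := by
    have h := hφ q hqball
    rwa [hu0, one_mul] at h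
  -- `λ τ = 16 · q · u q`
  have hmain : modularLambda τ = 16 * q * u q := by
    rw [hune q hq0, hΛq]
    field_simp
  rw [hmain, huq, Complex.exp_add, Complex.exp_add, hq]
  congr 1
  rw [Complex.ofReal_log (by norm_num : (0:ℝ) ≤ 16)]
  push_cast
  rw [Complex.exp_log (by norm_num)]

/-! ### §3 The competitor with its `τ`-relation -/

/-- The competitor `F = 16^{1/N}(λ(tᴺ)/16)^{1/N}` on the disc: holomorphic, `F(0) = 0`, values in
`{z | zᴺ ≠ 1}`, `F(t) = 0 → t = 0`, and `F(e^{πiτ/N})ᴺ = λ(τ)` for `Im τ > 0`.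
[cite: CalegariDimitrovTang2025, §4.2 proof of Lemma 23 and §3] -/
theorem exists_competitor_compl_rootsOfUnity' {N : ℕ} (hN : 0 < N) :
    ∃ F : ℂ → ℂ, DifferentiableOn ℂ F (ball (0 : ℂ) 1) ∧ F 0 = 0 ∧
      MapsTo F (ball (0 : ℂ) 1) {z : ℂ | z ^ N ≠ 1} ∧ (∀ t ∈ ball (0 : ℂ) 1, F t = 0 → t = 0) ∧
      ∀ τ : ℂ, 0 < τ.im → Complex.exp (π * Complex.I * τ / N) ∈ ball (0 : ℂ) 1 ∧
        F (Complex.exp (π * Complex.I * τ / N)) ^ N = modularLambda τ := by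
  obtain ⟨Φ, hΦd, hΦ0, -, hpow, hne⟩ := exists_root_cuspFunction_modularLambda hN
  have hN0 : (N : ℝ) ≠ 0 := by exact_mod_cast hN.ne'
  set r : ℝ := (16 : ℝ) ^ ((N : ℝ)⁻¹) with hr
  have hrpos : 0 < r := by positivity
  have hrN : r ^ N = 16 := by
    rw [hr, ← Real.rpow_natCast, ← Real.rpow_mul (by norm_num), inv_mul_cancel₀ hN0, Real.rpow_one]
  have hcN : ((r : ℂ)) ^ N = 16 := by exact_mod_cast hrN
  refine ⟨fun z ↦ (r : ℂ) * Φ z, hΦd.const_mul _, by simp [hΦ0], ?_, ?_, ?_⟩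
  · intro z hz
    show ((r : ℂ) * Φ z) ^ N ≠ 1
    intro h
    rw [mul_pow, hcN] at h
    exact hne z hz (by linear_combination (1 / 16 : ℂ) * h)
  · intro t ht h0
    have hΦt : Φ t = 0 := by
      rcases mul_eq_zero.mp h0 with h | h
      · exact absurd (by exact_mod_cast h : r = 0) hrpos.ne'
      · exact h
    by_contra ht0
    have htN : t ^ N ≠ 0 := pow_ne_zero _ ht0
    have htNball : ‖t ^ N‖ < 1 := by
      rw [norm_pow]; exact pow_lt_one₀ (norm_nonneg _) (by simpa using ht) hN.ne'
    have h1 := hpow t ht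
    rw [hΦt, zero_pow hN.ne'] at h1
    exact cuspFunction_modularLambda_ne_zero htNball htN h1.symm
  · intro τ hτ
    have hpowe : Complex.exp (π * Complex.I * τ / N) ^ N = Complex.exp (π * Complex.I * τ) := by
      rw [← Complex.exp_nat_mul, mul_div_cancel₀ _ (Nat.cast_ne_zero.mpr hN.ne')]
    have hball : Complex.exp (π * Complex.I * τ / N) ∈ ball (0 : ℂ) 1 := by
      rw [mem_ball_zero_iff]
      have h : ‖Complex.exp (π * Complex.I * τ / N)‖ ^ N < 1 := by
        rw [← norm_pow, hpowe, Complex.norm_exp]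
        have : (π * Complex.I * τ).re = -(π * τ.im) := by
          simp [Complex.mul_re, Complex.mul_im, Complex.I_re, Complex.I_im]
        rw [this, Real.exp_lt_one_iff]
        nlinarith [Real.pi_pos]
      contrapose! h
      exact one_le_pow₀ h
    refine ⟨hball, ?_⟩
    show ((r : ℂ) * Φ _) ^ N = _
    rw [mul_pow, hcN, hpow _ hball, hpowe, cuspFunction_modularLambda_exp hτ]
    ring

/-! ### §4 A zero of the covering at depth `≥ 1/(16N²)` -/

/-- Elementary bound: for `0 ≤ x ≤ 1/2` and `0 ≤ y ≤ 1 − d` with `0 ≤ d`: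
`(x + y)/(1 + x y) ≤ 1 − d/4`. [cite: Ahlfors1973, §1-1] -/
theorem add_div_one_add_mul_le {x y d : ℝ} (hx0 : 0 ≤ x) (hx : x ≤ 1 / 2) (hy0 : 0 ≤ y)
    (hy : y ≤ 1 - d) (hd0 : 0 ≤ d) : (x + y) / (1 + x * y) ≤ 1 - d / 4 := by
  rw [div_le_iff₀ (by positivity)]
  nlinarith [mul_nonneg hx0 hy0, mul_nonneg (sub_nonneg.2 hx) (sub_nonneg.2 hy),
    mul_nonneg hx0 hd0, mul_nonneg hy0 hd0, mul_nonneg (mul_nonneg hx0 hy0) hd0]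

/-- `1 − e^{−c} ≥ c/2` for `0 ≤ c ≤ 1`. [folklore] -/
private theorem half_le_one_sub_exp_neg {c : ℝ} (hc0 : 0 ≤ c) (hc1 : c ≤ 1) :
    c / 2 ≤ 1 - Real.exp (-c) := by
  have h1 : Real.exp (-c) ≤ 1 / (1 + c) := by
    rw [Real.exp_neg, one_div]
    exact inv_anti₀ (by positivity) (by linarith [Real.add_one_le_exp c])
  have h2 : 1 / (1 + c) ≤ 1 - c / 2 := by
    rw [div_le_iff₀ (by positivity)]
    nlinarith
  linarith

/-- ★ **A zero of the universal covering of `ℂ ∖ μ_N` at depth `≥ 1/(16 N²)`.** Let `Φ` be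
holomorphic on the unit disc, mapping it onto `{z | zᴺ ≠ 1}` as a covering map, `Φ(0) = 0`, `N ≥ 1`.
Then `Φ` has a zero `z₁ ≠ 0` with `‖z₁‖ ≤ 1 − 1/(16 N²)`. (CDT: the nearest nonzero zeros of `F_N`
are at `|z| = cos(π/2N) = 1 − π²/(8N²) + …`.) See the module docstring for the proof.
[cite: CalegariDimitrovTang2025, Theorem 5.1.4 and §5.3] -/
theorem exists_zero_norm_le_of_isCoveringMap_compl_rootsOfUnity {N : ℕ} (hN : 0 < N) {Φ : ℂ → ℂ}
    (hΦ : DifferentiableOn ℂ Φ (ball (0 : ℂ) 1)) (hΦU : MapsTo Φ (ball (0 : ℂ) 1) {z : ℂ | z ^ N ≠ 1})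
    (hcov : IsCoveringMap hΦU.restrict) (hΦ0 : Φ 0 = 0) :
    ∃ z₁ ∈ ball (0 : ℂ) 1, z₁ ≠ 0 ∧ Φ z₁ = 0 ∧ ‖z₁‖ ≤ 1 - 1 / (16 * (N : ℝ) ^ 2) := by
  have hb0 : (0 : ℂ) ∈ ball (0 : ℂ) 1 := mem_ball_self one_pos
  have hNpos : (0 : ℝ) < N := by exact_mod_cast hN
  have hNc : (N : ℂ) ≠ 0 := by exact_mod_cast hN.ne'
  -- competitor, lift, logarithms
  obtain ⟨F, hFd, hF0, hFU, hFz, hFτ⟩ := exists_competitor_compl_rootsOfUnity' hN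
  obtain ⟨ω, hωd, hωm, hω0, hΦω⟩ :=
    Complex.exists_discLift_of_isCoveringMap hΦ hΦU hcov hFd hFU hb0 (by rw [hΦ0, hF0])
  obtain ⟨φ, hφd, hφ0, hlam⟩ := exists_log_modularLambda_nome
  have hgd : DifferentiableOn ℂ (fun z ↦ Φ z ^ N - 1) (ball (0 : ℂ) 1) := (hΦ.pow N).sub_const 1
  have hgne : ∀ z ∈ ball (0 : ℂ) 1, Φ z ^ N - 1 ≠ 0 := fun z hz h ↦ hΦU hz (sub_eq_zero.mp h)
  obtain ⟨L, hLd, hL0, -, hLexp⟩ := exists_log_on_ball hgd hgne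
  simp only [hΦ0, zero_pow hN.ne', zero_sub] at hLexp
  -- `exp (L z) = 1 - Φ z ^ N`
  have hLexp' : ∀ z ∈ ball (0 : ℂ) 1, Complex.exp (L z) = 1 - Φ z ^ N := by
    intro z hz
    have h := hLexp z hz
    linear_combination h
  -- the path data
  set h : ℝ → ℂ := fun s ↦ -2 * (s : ℂ) + Complex.I * (N : ℂ)⁻¹ with hh
  have hh_im : ∀ s, (h s).im = (N : ℝ)⁻¹ := by
    intro s; simp [hh, Complex.mul_im, Complex.I_re, Complex.I_im]
  have hh_ne : ∀ s, h s ≠ 0 := fun s hs ↦ by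
    have := congrArg Complex.im hs
    rw [hh_im, Complex.zero_im] at this
    exact (inv_ne_zero hNpos.ne') this
  have hh_pos : ∀ s, 0 < (h s).im := fun s ↦ by rw [hh_im]; positivity
  set σ : ℝ → ℂ := fun s ↦ -1 / h s with hσ
  have hσ_im : ∀ s, (σ s).im = (N : ℝ)⁻¹ / Complex.normSq (h s) := by
    intro s
    show (-1 / h s).im = _
    rw [div_eq_mul_inv, neg_one_mul, Complex.neg_im, Complex.inv_im, hh_im]
    ring
  have hσ_pos : ∀ s, 0 < (σ s).im := fun s ↦ by
    rw [hσ_im]; exact div_pos (by positivity) (Complex.normSq_pos.2 (hh_ne s))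
  have hσ_inv : ∀ s, -1 / σ s = h s := fun s ↦ by
    rw [hσ]; field_simp [hh_ne s]
  set β : ℝ → ℂ := fun s ↦ Complex.exp (π * Complex.I * σ s / N) with hβ
  have hβball : ∀ s, β s ∈ ball (0 : ℂ) 1 := fun s ↦ (hFτ (σ s) (hσ_pos s)).1
  have hFβ : ∀ s, F (β s) ^ N = modularLambda (σ s) := fun s ↦ (hFτ (σ s) (hσ_pos s)).2
  have hβne : ∀ s, β s ≠ 0 := fun s ↦ Complex.exp_ne_zero _
  -- the two logarithms along the path agree up to a constant
  set A : ℝ → ℂ := fun s ↦ L (ω (β s)) with hA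
  set B : ℝ → ℂ := fun s ↦ ((Real.log 16 : ℝ) : ℂ) + π * Complex.I * h s +
    φ (Complex.exp (π * Complex.I * h s)) with hB
  have hexpAB : ∀ s, Complex.exp (A s) = Complex.exp (B s) := by
    intro s
    have hωβ : ω (β s) ∈ ball (0 : ℂ) 1 := hωm (hβball s)
    show Complex.exp (L (ω (β s))) = Complex.exp (((Real.log 16 : ℝ) : ℂ) + π * Complex.I * h s +
      φ (Complex.exp (π * Complex.I * h s)))
    rw [hLexp' _ hωβ, hΦω _ (hβball s), hFβ s, ← modularLambda_neg_one_div (hσ_pos s), hσ_inv s,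
      hlam (h s) (hh_pos s)]
  -- continuity of `A` and `B`
  have hh_cont : Continuous h := by
    simp only [hh]; fun_prop
  have hσ_cont : Continuous σ := by
    simp only [hσ]
    exact continuous_const.div hh_cont hh_ne
  have hβ_cont : Continuous β := by
    simp only [hβ]
    exact Complex.continuous_exp.comp ((continuous_const.mul hσ_cont).div_const _)
  have hA_cont : Continuous A := by
    refine hLd.continuousOn.comp_continuous (hωd.continuousOn.comp_continuous hβ_cont hβball) ?_
    exact fun s ↦ hωm (hβball s)
  have hexp_ball : ∀ s, Complex.exp (π * Complex.I * h s) ∈ ball (0 : ℂ) 1 := by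
    intro s
    rw [mem_ball_zero_iff, Complex.norm_exp]
    have : (π * Complex.I * h s).re = -(π * (h s).im) := by
      simp [Complex.mul_re, Complex.mul_im, Complex.I_re, Complex.I_im]
    rw [this, Real.exp_lt_one_iff]
    nlinarith [Real.pi_pos, hh_pos s]
  have hB_cont : Continuous B := by
    simp only [hB]
    refine (continuous_const.add (continuous_const.mul hh_cont)).add ?_
    exact hφd.continuousOn.comp_continuous (Complex.continuous_exp.comp (continuous_const.mul hh_cont))
      hexp_ball
  obtain ⟨n, hn⟩ := exists_int_eqOn_add_of_exp_eqOn isPreconnected_univ hA_cont.continuousOn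
    hB_cont.continuousOn (fun s _ ↦ hexpAB s) (mem_univ (0 : ℝ))
  have hAB : A 1 - A 0 = B 1 - B 0 := by
    rw [hn (mem_univ 1), hn (mem_univ 0)]; ring
  -- `B 1 − B 0 = −2πi`
  have hh1 : h 1 = h 0 - 2 := by
    show -2 * ((1 : ℝ) : ℂ) + Complex.I * (N : ℂ)⁻¹ = (-2 * ((0 : ℝ) : ℂ) + Complex.I * (N : ℂ)⁻¹) - 2
    push_cast; ring
  have hB10 : B 1 - B 0 = -(2 * π * Complex.I) := by
    have he : Complex.exp (π * Complex.I * h 1) = Complex.exp (π * Complex.I * h 0) := by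
      rw [hh1, mul_sub, Complex.exp_sub, show (π : ℂ) * Complex.I * 2 = 2 * π * Complex.I by ring,
        Complex.exp_two_pi_mul_I, div_one]
    show (((Real.log 16 : ℝ) : ℂ) + π * Complex.I * h 1 + φ (Complex.exp (π * Complex.I * h 1))) -
      ((((Real.log 16 : ℝ) : ℂ) + π * Complex.I * h 0 + φ (Complex.exp (π * Complex.I * h 0)))) = _
    rw [he, hh1]; ring
  -- the endpoints `t₀ = β 0`, `t₁ = β 1` and the root of unity `ζ`
  have hlamσ : modularLambda (σ 1) = modularLambda (σ 0) := by
    have e1 : modularLambda (σ 1) = 1 - modularLambda (h 1) := by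
      rw [← hσ_inv 1, modularLambda_neg_one_div (hσ_pos 1)]; ring
    have e0 : modularLambda (σ 0) = 1 - modularLambda (h 0) := by
      rw [← hσ_inv 0, modularLambda_neg_one_div (hσ_pos 0)]; ring
    rw [e1, e0, hh1, ← modularLambda_add_two (h 0 - 2), sub_add_cancel]
  have hFt0 : F (β 0) ≠ 0 := fun h0 ↦ hβne 0 (hFz _ (hβball 0) h0)
  set ζ : ℂ := F (β 1) / F (β 0) with hζ
  have hζN : ζ ^ N = 1 := by rw [hζ, div_pow, hFβ, hFβ, hlamσ, div_self]; rw [← hFβ]; exact pow_ne_zero _ hFt0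
  have hFβ1 : F (β 1) = ζ * F (β 0) := by rw [hζ, div_mul_cancel₀ _ hFt0]
  have hζ1 : ‖ζ‖ = 1 := by
    have h := congrArg norm hζN
    rw [norm_pow, norm_one] at h
    exact (pow_eq_one_iff_of_nonneg (norm_nonneg ζ) hN.ne').1 h
  set a : ℂ := ω (β 0) with ha
  set b : ℂ := ω (β 1) with hb
  have haball : a ∈ ball (0 : ℂ) 1 := hωm (hβball 0)
  have hbball : b ∈ ball (0 : ℂ) 1 := hωm (hβball 1)
  have hζaball : ζ * a ∈ ball (0 : ℂ) 1 := by
    rw [mem_ball_zero_iff, norm_mul, hζ1, one_mul]; exact mem_ball_zero_iff.1 haball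
  have hfibre : Φ (ζ * a) = Φ b := by
    rw [apply_mul_eq_mul_apply_of_isCoveringMap_compl_rootsOfUnity hΦ hΦU hcov hΦ0 hζN haball, ha, hb,
      hΦω _ (hβball 0), hΦω _ (hβball 1), hFβ1]
  -- the two fibre points are distinct: `L(ζ z) = L(z)` but `A 1 − A 0 = −2πi`
  have hLζ : EqOn (fun z ↦ L (ζ * z)) L (ball (0 : ℂ) 1) := by
    have hmaps : MapsTo (fun z : ℂ ↦ ζ * z) (ball (0 : ℂ) 1) (ball (0 : ℂ) 1) := by
      intro z hz
      rw [mem_ball_zero_iff, norm_mul, hζ1, one_mul]; exact mem_ball_zero_iff.1 hz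
    refine eqOn_of_exp_eqOn (convex_ball (0 : ℂ) 1).isPreconnected
      (hLd.continuousOn.comp (continuous_const.mul continuous_id).continuousOn hmaps) hLd.continuousOn
      (fun z hz ↦ ?_) hb0 (by simp)
    rw [hLexp' _ (hmaps hz), hLexp' _ hz,
      apply_mul_eq_mul_apply_of_isCoveringMap_compl_rootsOfUnity hΦ hΦU hcov hΦ0 hζN hz, mul_pow, hζN,
      one_mul]
  have hne : ζ * a ≠ b := by
    intro heq
    have h1 : A 1 = A 0 := by
      show L (ω (β 1)) = L (ω (β 0))
      rw [← hb, ← heq]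
      exact hLζ haball
    have h2 : B 1 - B 0 = 0 := by rw [← hAB, h1, sub_self]
    rw [hB10, neg_eq_zero] at h2
    exact Complex.two_pi_I_ne_zero h2
  -- the deck lift `T` of `Φ ∘ μ` with `T 0 = b`, `μ(0) = ζ a`
  set μ : ℂ → ℂ := discMobius (-(ζ * a)) with hμ
  have hζa1 : ‖-(ζ * a)‖ < 1 := by rw [norm_neg]; exact mem_ball_zero_iff.1 hζaball
  have hμd : DifferentiableOn ℂ μ (ball (0 : ℂ) 1) := Complex.differentiableOn_discMobius hζa1
  have hμm : MapsTo μ (ball (0 : ℂ) 1) (ball (0 : ℂ) 1) := Complex.mapsTo_discMobius hζa1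
  have hμ0 : μ 0 = ζ * a := by simp [hμ]
  have hμself : μ (-(ζ * a)) = 0 := by simp [hμ]
  have hnegball : -(ζ * a) ∈ ball (0 : ℂ) 1 := mem_ball_zero_iff.2 hζa1
  obtain ⟨T, hTd, hTm, hT0, hΦT⟩ := Complex.exists_discLift_of_isCoveringMap hΦ hΦU hcov
    (g := fun z ↦ Φ (μ z)) (hΦ.comp hμd hμm) (hΦU.comp hμm) hbball (by simp only [hμ0]; exact hfibre.symm)
  -- the zero `z₁ = T (μ⁻¹ 0)`
  refine ⟨T (-(ζ * a)), hTm hnegball, ?_, ?_, ?_⟩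
  · -- nonzero by uniqueness of lifts
    intro hz
    have heqOn := Complex.eqOn_of_lifts_of_isCoveringMap hΦU hcov hTd.continuousOn hTm hμd.continuousOn hμm
      (fun z hz' ↦ hΦT z hz') hnegball (by rw [hz, hμself])
    have := heqOn hb0
    rw [hT0, hμ0] at this
    exact hne this.symm
  · rw [hΦT _ hnegball, hμself, hΦ0]
  · -- Schwarz–Pick bookkeeping
    have hSP := norm_le_of_mapsTo_ball_two_point hTd hTm hζa1
    rw [hT0, norm_neg, norm_mul, hζ1, one_mul] at hSP
    have hωm' : MapsTo ω (ball (0 : ℂ) 1) (closedBall (0 : ℂ) 1) := hωm.mono_right ball_subset_closedBall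
    have ha_le : ‖a‖ ≤ ‖β 0‖ :=
      Complex.norm_le_norm_of_mapsTo_ball hωd hωm' hω0 (mem_ball_zero_iff.1 (hβball 0))
    have hb_le : ‖b‖ ≤ ‖β 1‖ :=
      Complex.norm_le_norm_of_mapsTo_ball hωd hωm' hω0 (mem_ball_zero_iff.1 (hβball 1))
    -- `‖β 0‖ = e^{-π} ≤ 1/2`
    have hσ0 : σ 0 = Complex.I * N := by
      show -1 / (-2 * ((0 : ℝ) : ℂ) + Complex.I * (N : ℂ)⁻¹) = Complex.I * N
      rw [Complex.ofReal_zero, mul_zero, zero_add,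
        div_eq_iff (mul_ne_zero Complex.I_ne_zero (inv_ne_zero hNc))]
      have e : Complex.I * (N : ℂ) * (Complex.I * (N : ℂ)⁻¹) =
          Complex.I * Complex.I * ((N : ℂ) * (N : ℂ)⁻¹) := by ring
      rw [e, Complex.I_mul_I, mul_inv_cancel₀ hNc]; ring
    have hβ0 : ‖β 0‖ = Real.exp (-π) := by
      show ‖Complex.exp (π * Complex.I * σ 0 / N)‖ = Real.exp (-π)
      rw [hσ0, Complex.norm_exp]
      have e : (π : ℂ) * Complex.I * (Complex.I * N) / N = ((-π : ℝ) : ℂ) := by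
        have e' : (π : ℂ) * Complex.I * (Complex.I * N) / N =
            π * (Complex.I * Complex.I) * ((N : ℂ) / N) := by ring
        rw [e', Complex.I_mul_I, div_self hNc]; push_cast; ring
      rw [e, Complex.ofReal_re]
    have hx : ‖a‖ ≤ 1 / 2 := by
      refine ha_le.trans ?_
      rw [hβ0, Real.exp_neg]
      have : (2 : ℝ) ≤ Real.exp π := by linarith [Real.add_one_le_exp π, Real.pi_gt_three]
      rw [inv_le_comm₀ (Real.exp_pos _) (by norm_num)]
      linarith
    -- `‖β 1‖ = exp(−π · im σ(1)/N) ≤ 1 − 3/(10 N²)`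
    set c : ℝ := π * (σ 1).im / N with hc
    have hβ1 : ‖β 1‖ = Real.exp (-c) := by
      show ‖Complex.exp (π * Complex.I * σ 1 / N)‖ = Real.exp (-c)
      rw [Complex.norm_exp]
      congr 1
      have e : (π : ℂ) * Complex.I * σ 1 / N = ((π / N : ℝ) : ℂ) * (Complex.I * σ 1) := by
        push_cast; field_simp
      rw [e, Complex.re_ofReal_mul, Complex.I_mul_re, hc]; ring
    -- `c = π/(4N² + 1)`
    have hnormSq : Complex.normSq (h 1) = 4 + ((N : ℝ) ^ 2)⁻¹ := by
      show Complex.normSq (-2 * ((1 : ℝ) : ℂ) + Complex.I * (N : ℂ)⁻¹) = _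
      rw [Complex.normSq_apply]
      simp [Complex.mul_re, Complex.mul_im, Complex.I_re, Complex.I_im]
      ring
    have hc_eq : c = π / (4 * (N : ℝ) ^ 2 + 1) := by
      rw [hc, hσ_im 1, hnormSq]
      field_simp
    have hc0 : 0 ≤ c := by rw [hc_eq]; positivity
    have hc1 : c ≤ 1 := by
      rw [hc_eq, div_le_one (by positivity)]
      have h1 : (1 : ℝ) ≤ (N : ℝ) ^ 2 := by
        have : (1 : ℝ) ≤ N := by exact_mod_cast hN
        nlinarith
      linarith [Real.pi_lt_four]
    have hc_ge : 1 / (2 * (N : ℝ) ^ 2) ≤ c := by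
      rw [hc_eq, div_le_div_iff₀ (by positivity) (by positivity)]
      have h1 : (1 : ℝ) ≤ (N : ℝ) ^ 2 := by
        have : (1 : ℝ) ≤ N := by exact_mod_cast hN
        nlinarith
      nlinarith [Real.pi_gt_three]
    have hy : ‖b‖ ≤ 1 - c / 2 := by
      refine hb_le.trans ?_
      rw [hβ1]
      linarith [half_le_one_sub_exp_neg hc0 hc1]
    have hfin := add_div_one_add_mul_le (norm_nonneg a) hx (norm_nonneg b) hy (by positivity)
    calc ‖T (-(ζ * a))‖ ≤ (‖a‖ + ‖b‖) / (1 + ‖a‖ * ‖b‖) := hSP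
      _ ≤ 1 - c / 2 / 4 := hfin
      _ ≤ 1 - 1 / (16 * (N : ℝ) ^ 2) := by
          have : 1 / (16 * (N : ℝ) ^ 2) = (1 / (2 * (N : ℝ) ^ 2)) / 2 / 4 := by ring
          rw [this]
          linarith

end Literature.Analysis.Complex

end
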